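import Summits.BirchSwinnertonDyer.Rank1Residual.X1.GeneratorBoundFitting
import Summits.BirchSwinnertonDyer.Rank1Residual.X1.GeneratorCountLayer
import Literature.RingTheory.FittingIdeal.DiscreteValuationRing
import Literature.NumberTheory.EllipticCurves.SkinnerUrban2014.CharacteristicIdealBaseChangeProofs
import Literature.NumberTheory.EllipticCurves.IwasawaAlgebraPseudoNullProofs
import Mathlib.RingTheory.Regular.Free
import Mathlib.LinearAlgebra.Dimension.Localization
import Mathlib.LinearAlgebra.Dimension.Torsion.Finite
import Mathlib.LinearAlgebra.FreeModule.PID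
import Mathlib.RingTheory.PowerSeries.NoZeroDivisors
import HarnessLib

/-!
# LEMMA M in the kernel, ord form: `p^B ≤ #(X/𝔪X)` and no finite submodule ⇒ `char(X) ⊆ 𝔪^B`

B2B cell `bsd-rank1-residual`, unit `eisenstein-p1` GEN 17, FILE 11 (X1R0-GAPMAP §21.1 — the
"unprinted" LEMMA M of route M — and §26; `V76-LOCAL-TERM-PLAN.md` §3). HONEST FRAMING: research
route; THEOREMS ONLY (no `def`, no named fact); nothing booked.

For a finitely generated torsion `Λ = ℤ_p⟦T⟧`-module `X` WITHOUT non-zero finite submodules: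

* §1–§2 (`exists_eq_X_smul_of_smul_eq`): for a presentation `0 → K → Λ^g → X → 0`, `K` is
  `T`-saturated in the strong sense `a·k ∈ T·K, a(0) ≠ 0 ⇒ k ∈ T·K` (the obstruction is an
  element of `X` killed by `T` and `p^k`, which spans a FINITE submodule);
* §3 (`free_ker`): hence `K/TK` is a finitely generated torsion-free module over the principal
  ideal domain `Λ/(T) ≅ ℤ_p`, so free, so `K` is free (Mathlib's Nakayama lift
  `Module.free_quotSMulTop_iff_free` for the `K`-regular element `T ∈ 𝔪`), of rank `g` (`X` is
  torsion) — i.e. `pd_Λ X ≤ 1` and `X` has a SQUARE presentation;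
* §4 (`exists_fittingIdeal_zero_eq_span`): with a minimal generating family the relation matrix
  `P` has entries in `𝔪` (FILE 10), so `Fitt₀(X) = (det P)` with `det P ∈ 𝔪^g ⊆ 𝔪^B`; and
  `char(X) = Fitt₀(X)` (`charIdeal_eq_fittingIdeal_zero`, squeezed by the tree's S–U §3.1.6
  lemmas);
* §5 (`charIdeal_le_maximalIdeal_pow`): by Skinner–Urban §3.1.6 in the tree
  (`charIdeal_le_span_singleton_of_fittingIdeal_zero_le`: a principal ideal containing `Fitt₀`
  contains `char`), **`char(X) ⊆ (det P) ⊆ 𝔪^B`**, and for a generator `f` of `char(X)`: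
  **`p^{B−i} ∣ f_i` for all `i`** (`ord_𝔪 f ≥ B`; `i = 0` is LEMMA M₀ of `X1/GeneratorBound`);
* §6: the route-M reading through the typed inputs `GeneratorCountGE` / `NoFiniteSubmoduleAt`.

## Sources
* R. Greenberg, LNM 1716 (1999), p. 137 (the count `dim X/𝔪X`), Prop. 4.14–4.15 (no finite
  submodules).
* C. Skinner, E. Urban, Invent. Math. 195 (2014), §3.1.6 (Fitting vs characteristic ideals) —
  tree `SkinnerUrban2014/CharacteristicIdealBaseChangeProofs.lean`.
* D. Eisenbud, GTM 150, §20.2; Stacks 07Z6 (Fitting ideal of a square presentation) — tree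
  `Literature/RingTheory/FittingIdeal/`.
* L. Washington, GTM 83, §13.2 (structure of `Λ`-modules).
-/

namespace Summit.BirchSwinnertonDyer.Rank1Residual.X1.GeneratorBoundOrd

open Literature.RingTheory.FittingIdeal IsLocalRing PowerSeries
  Literature.NumberTheory.EllipticCurves Literature.NumberTheory.GaloisRepresentations
  Literature.NumberTheory.EllipticCurves.IwasawaAlgebra
  Literature.NumberTheory.EllipticCurves.Rank1Residual
  Literature.NumberTheory.EllipticCurves.Greenberg1999
  Summit.BirchSwinnertonDyer.Rank1Residual.X1.GeneratorBoundFitting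

open scoped Pointwise

variable {p : ℕ} [Fact p.Prime]

/-! ## §1. `𝔪^k ⊆ (p^k, T)`; an element killed by `T` and `p^k` spans a finite submodule -/

/-- `𝔪^k ⊆ (p^k, T)` in `Λ = ℤ_p⟦T⟧`. [folklore] -/
theorem maximalIdeal_pow_le_span_C_pow_X (k : ℕ) :
    maximalIdeal (IwasawaAlgebra p) ^ k ≤
      Ideal.span {(C ((p : ℤ_[p]) ^ k) : IwasawaAlgebra p), (X : IwasawaAlgebra p)} := by
  induction k with
  | zero =>
    rw [pow_zero, pow_zero, map_one, Ideal.one_eq_top]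
    exact le_of_eq
      (Ideal.eq_top_of_isUnit_mem _ (Ideal.subset_span (Set.mem_insert _ _)) isUnit_one).symm
  | succ k ih =>
    rw [pow_succ]
    refine (Ideal.mul_mono ih GeneratorCountLayer.maximalIdeal_le_span_C_p_X).trans ?_
    rw [Ideal.span_pair_mul_span_pair]
    refine Ideal.span_le.2 ?_
    rintro z hz
    simp only [Set.mem_insert_iff, Set.mem_singleton_iff] at hz
    rw [SetLike.mem_coe, Ideal.mem_span_pair]
    rcases hz with rfl | rfl | rfl | rfl
    · exact ⟨1, 0, by rw [← map_mul, ← pow_succ]; ring⟩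
    · exact ⟨0, C ((p : ℤ_[p]) ^ k), by ring⟩
    · exact ⟨0, C (p : ℤ_[p]), by ring⟩
    · exact ⟨0, X, by ring⟩

variable {M : Type*} [AddCommGroup M] [Module (IwasawaAlgebra p) M]

/-- An element `y` of a `Λ`-module with `T·y = 0` and `p^k·y = 0` spans a FINITE submodule
(a quotient of `Λ/𝔪^k`). [folklore] -/
theorem finite_span_singleton_of_smul_eq_zero (y : M) (k : ℕ)
    (hX : (X : IwasawaAlgebra p) • y = 0) (hp : (C ((p : ℤ_[p]) ^ k) : IwasawaAlgebra p) • y = 0) :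
    Finite (Submodule.span (IwasawaAlgebra p) {y}) := by
  haveI := IwasawaAlgebra.finite_quotient_maximalIdeal_pow p k
  have hann : (maximalIdeal (IwasawaAlgebra p) ^ k : Submodule (IwasawaAlgebra p) (IwasawaAlgebra p))
      ≤ LinearMap.ker (LinearMap.toSpanSingleton (IwasawaAlgebra p) M y) := by
    intro r hr
    rw [LinearMap.mem_ker, LinearMap.toSpanSingleton_apply]
    obtain ⟨a, b, rfl⟩ := Ideal.mem_span_pair.1 (maximalIdeal_pow_le_span_C_pow_X k hr)
    rw [add_smul, mul_smul, mul_smul, hp, hX, smul_zero, smul_zero, add_zero]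
  set φ := (maximalIdeal (IwasawaAlgebra p) ^ k).liftQ
    (LinearMap.toSpanSingleton (IwasawaAlgebra p) M y) hann with hφ
  have hrange : LinearMap.range φ = Submodule.span (IwasawaAlgebra p) {y} := by
    rw [hφ, Submodule.range_liftQ, LinearMap.span_singleton_eq_range]
  rw [← hrange]
  exact Finite.of_surjective _ φ.surjective_rangeRestrict

/-! ## §2. The relation module is `T`-saturated -/

/-- **Saturation.** Let `π : Λ^g → X` be `Λ`-linear, `X` without non-zero finite submodules,
`k, k' ∈ ker π`, `a ∈ Λ` with `a(0) ≠ 0` and `a·k = T·k'`. Then `k = T·m` with `m ∈ ker π`: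
`T ∣ k` componentwise (`T` prime, `T ∤ a`), and `y = π(m)` is killed by `T` and by `a`, hence by
`p^{v_p(a(0))}`, so `Λ·y` is finite, so `y = 0`. [folklore] -/
theorem exists_eq_X_smul_of_smul_eq {g : ℕ} (π : (Fin g → IwasawaAlgebra p) →ₗ[IwasawaAlgebra p] M)
    (hnf : ∀ N : Submodule (IwasawaAlgebra p) M, Finite N → N = ⊥)
    {k k' : Fin g → IwasawaAlgebra p} (hk : k ∈ LinearMap.ker π) (hk' : k' ∈ LinearMap.ker π)
    {a : IwasawaAlgebra p} (ha : constantCoeff a ≠ 0)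
    (h : a • k = (X : IwasawaAlgebra p) • k') :
    ∃ m ∈ LinearMap.ker π, k = (X : IwasawaAlgebra p) • m := by
  have hdvd : ∀ l, (X : IwasawaAlgebra p) ∣ k l := fun l => by
    have h1 : a * k l = X * k' l := by
      simpa only [Pi.smul_apply, smul_eq_mul] using congr_fun h l
    have h2 : (X : IwasawaAlgebra p) ∣ a * k l := ⟨k' l, h1⟩
    exact (X_prime.dvd_or_dvd h2).resolve_left (by rwa [X_dvd_iff])
  choose m hm using hdvd
  have hkm : k = (X : IwasawaAlgebra p) • m := funext fun l => by
    rw [Pi.smul_apply, smul_eq_mul]; exact hm l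
  have hXreg : IsSMulRegular (Fin g → IwasawaAlgebra p) (X : IwasawaAlgebra p) :=
    IsSMulRegular.pi fun _ => (IsRegular.of_ne_zero X_ne_zero).left.isSMulRegular
  have ham : a • m = k' := by
    apply hXreg
    show (X : IwasawaAlgebra p) • (a • m) = (X : IwasawaAlgebra p) • k'
    rw [smul_comm, ← hkm, h]
  set y := π m with hy
  have hXy : (X : IwasawaAlgebra p) • y = 0 := by rw [hy, ← map_smul, ← hkm]; exact hk
  have hay : a • y = 0 := by rw [hy, ← map_smul, ham]; exact hk'
  have hCa : (C (constantCoeff a) : IwasawaAlgebra p) • y = 0 := by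
    have h3 := eq_X_mul_shift_add_const a
    have h4 : a • y = ((X : IwasawaAlgebra p) * PowerSeries.mk fun i => coeff (i + 1) a) • y +
        (C (constantCoeff a) : IwasawaAlgebra p) • y := by
      conv_lhs => rw [h3]
      rw [add_smul]
    rw [hay, mul_comm, mul_smul, hXy, smul_zero, zero_add] at h4
    exact h4.symm
  have hpk : (C ((p : ℤ_[p]) ^ (constantCoeff a).valuation) : IwasawaAlgebra p) • y = 0 := by
    have h5 := PadicInt.unitCoeff_spec ha
    have hu : (((PadicInt.unitCoeff ha)⁻¹ : ℤ_[p]ˣ) : ℤ_[p]) * constantCoeff a =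
        (p : ℤ_[p]) ^ (constantCoeff a).valuation :=
      calc (((PadicInt.unitCoeff ha)⁻¹ : ℤ_[p]ˣ) : ℤ_[p]) * constantCoeff a
          = (((PadicInt.unitCoeff ha)⁻¹ : ℤ_[p]ˣ) : ℤ_[p]) *
              ((PadicInt.unitCoeff ha : ℤ_[p]) * (p : ℤ_[p]) ^ (constantCoeff a).valuation) := by
            rw [← h5]
        _ = (p : ℤ_[p]) ^ (constantCoeff a).valuation := Units.inv_mul_cancel_left _ _
    rw [← hu, map_mul, mul_smul, hCa, smul_zero]
  have hfin := finite_span_singleton_of_smul_eq_zero y _ hXy hpk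
  have hy0 : y = 0 := by
    have := hnf _ hfin
    rwa [Submodule.span_singleton_eq_bot] at this
  refine ⟨m, ?_, hkm⟩
  rw [LinearMap.mem_ker, ← hy, hy0]

/-! ## §3. `K/TK` is torsion-free over `Λ/(T) ≅ ℤ_p`, so `K` is free of rank `g` -/

/-- `K/TK` is a torsion-free `Λ/(T)`-module (`K = ker π`, `X` without finite submodules).
[folklore] -/
theorem noZeroSMulDivisors_quotSMulTop {g : ℕ}
    (π : (Fin g → IwasawaAlgebra p) →ₗ[IwasawaAlgebra p] M)
    (hnf : ∀ N : Submodule (IwasawaAlgebra p) M, Finite N → N = ⊥) :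
    NoZeroSMulDivisors (IwasawaAlgebra p ⧸ Ideal.span {(X : IwasawaAlgebra p)})
      (QuotSMulTop (X : IwasawaAlgebra p) (LinearMap.ker π)) := by
  refine ⟨fun {c z} hcz => ?_⟩
  obtain ⟨a, rfl⟩ := Ideal.Quotient.mk_surjective c
  obtain ⟨z, rfl⟩ := Submodule.Quotient.mk_surjective _ z
  by_cases ha : constantCoeff a = 0
  · left
    rw [Ideal.Quotient.eq_zero_iff_mem, Ideal.mem_span_singleton]
    exact X_dvd_iff.2 ha
  · right
    have h1 : (Submodule.Quotient.mk (a • z) :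
        QuotSMulTop (X : IwasawaAlgebra p) (LinearMap.ker π)) = 0 := by
      rw [← hcz, Module.IsTorsionBy.mk_smul (Module.isTorsionBy_quotient_element_smul _ _),
        Submodule.Quotient.mk_smul]
    rw [Submodule.Quotient.mk_eq_zero, Submodule.mem_smul_pointwise_iff_exists] at h1
    obtain ⟨k', -, hk'⟩ := h1
    have h2 : a • (z : Fin g → IwasawaAlgebra p) = (X : IwasawaAlgebra p) • (k' : Fin g → _) := by
      have := congr_arg Subtype.val hk'
      simpa using this.symm
    obtain ⟨m, hm, hzm⟩ := exists_eq_X_smul_of_smul_eq π hnf z.2 k'.2 ha h2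
    rw [Submodule.Quotient.mk_eq_zero, Submodule.mem_smul_pointwise_iff_exists]
    exact ⟨⟨m, hm⟩, Submodule.mem_top, Subtype.ext (by simpa using hzm.symm)⟩

/-- **`pd_Λ X ≤ 1`:** for `X` without non-zero finite submodules, the kernel of any
`π : Λ^g → X` is a FREE `Λ`-module: `T ∈ 𝔪` is `K`-regular, `K/TK` is finitely generated and
torsion-free over the PID `Λ/(T)`, hence free, and freeness lifts (Nakayama,
`Module.free_quotSMulTop_iff_free`). [cite: Washington1997, §13.2] -/
theorem free_ker {g : ℕ} (π : (Fin g → IwasawaAlgebra p) →ₗ[IwasawaAlgebra p] M)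
    (hnf : ∀ N : Submodule (IwasawaAlgebra p) M, Finite N → N = ⊥) :
    Module.Free (IwasawaAlgebra p) (LinearMap.ker π) := by
  set K := LinearMap.ker π
  haveI : Module.FinitePresentation (IwasawaAlgebra p) K :=
    Module.finitePresentation_of_finite (IwasawaAlgebra p) K
  have hmem : (X : IwasawaAlgebra p) ∈ (⊥ : Ideal (IwasawaAlgebra p)).jacobson := by
    rw [IsLocalRing.jacobson_eq_maximalIdeal ⊥ bot_ne_top, mem_maximalIdeal, mem_nonunits_iff]
    intro hu
    have := hu.map (constantCoeff (R := ℤ_[p]))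
    rw [constantCoeff_X] at this
    exact not_isUnit_zero this
  have hXreg : IsSMulRegular (Fin g → IwasawaAlgebra p) (X : IwasawaAlgebra p) :=
    IsSMulRegular.pi fun _ => (IsRegular.of_ne_zero X_ne_zero).left.isSMulRegular
  have hreg : IsSMulRegular K (X : IwasawaAlgebra p) := hXreg.submodule K (X : IwasawaAlgebra p)
  haveI := SkinnerUrban2014.isDomain_quotient_span_X p
  haveI := SkinnerUrban2014.isPrincipalIdealRing_quotient_span_X p
  haveI := noZeroSMulDivisors_quotSMulTop π hnf
  haveI : Module.Finite (IwasawaAlgebra p ⧸ Ideal.span {(X : IwasawaAlgebra p)})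
      (QuotSMulTop (X : IwasawaAlgebra p) K) :=
    Module.Finite.of_restrictScalars_finite (IwasawaAlgebra p) _ _
  have hfree : Module.Free (IwasawaAlgebra p ⧸ Ideal.span {(X : IwasawaAlgebra p)})
      (QuotSMulTop (X : IwasawaAlgebra p) K) :=
    Module.free_of_finite_type_torsion_free'
  exact (Module.free_quotSMulTop_iff_free (IwasawaAlgebra p) K hmem hreg).1 hfree

/-- The kernel of a surjection `Λ^g → X` onto a TORSION module has rank `g`. [folklore] -/
theorem finrank_ker_eq {g : ℕ} (π : (Fin g → IwasawaAlgebra p) →ₗ[IwasawaAlgebra p] M)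
    (hπ : Function.Surjective π) (hM : Module.IsTorsion (IwasawaAlgebra p) M)
    [Module.Free (IwasawaAlgebra p) (LinearMap.ker π)] :
    Module.finrank (IwasawaAlgebra p) (LinearMap.ker π) = g := by
  have h1 := rank_quotient_add_rank_of_isDomain (LinearMap.ker π)
  have h2 : Module.rank (IwasawaAlgebra p) ((Fin g → IwasawaAlgebra p) ⧸ LinearMap.ker π) = 0 := by
    rw [rank_eq_zero_iff_isTorsion]
    intro q
    obtain ⟨a, ha⟩ := @hM (π.quotKerEquivOfSurjective hπ q)
    refine ⟨a, (π.quotKerEquivOfSurjective hπ).injective ?_⟩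
    rw [map_zero, Submonoid.smul_def, map_smul, ← Submonoid.smul_def]
    exact ha
  rw [h2, zero_add, rank_fin_fun] at h1
  exact Module.finrank_eq_of_rank_eq h1

/-! ## §4. A square minimal presentation: `Fitt₀(X) = (det P)`, `det P ∈ 𝔪^B` -/

/-- **Square minimal presentation.** For a finitely generated torsion `Λ`-module `X` without
non-zero finite submodules: `Fitt₀(X) = (d)` with `d ∈ 𝔪^g`, where `g` is the minimal number of
generators of `X` (`d = det P` for the `g × g` relation matrix `P` of a minimal generating
family — its rows are a basis of the free rank-`g` module `ker(Λ^g → X)` — all entries of `P` in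
`𝔪`). [cite: StacksProject, Tag 07Z6] -/
theorem exists_fittingIdeal_zero_eq_span_of_minimal [Module.Finite (IwasawaAlgebra p) M]
    (hM : Module.IsTorsion (IwasawaAlgebra p) M)
    (hnf : ∀ N : Submodule (IwasawaAlgebra p) M, Finite N → N = ⊥) :
    ∃ (g : ℕ) (d : IwasawaAlgebra p),
      (∃ x : Fin g → M, Submodule.span (IwasawaAlgebra p) (Set.range x) = ⊤) ∧
      (∀ (m : ℕ) (y : Fin m → M), Submodule.span (IwasawaAlgebra p) (Set.range y) = ⊤ → g ≤ m) ∧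
      Module.fittingIdeal (IwasawaAlgebra p) M 0 = Ideal.span {d} ∧
      d ∈ maximalIdeal (IwasawaAlgebra p) ^ g := by
  classical
  have hex : ∃ n, ∃ y : Fin n → M, Submodule.span (IwasawaAlgebra p) (Set.range y) = ⊤ :=
    Module.Finite.exists_fin
  obtain ⟨x, hx⟩ : ∃ y : Fin (Nat.find hex) → M,
    Submodule.span (IwasawaAlgebra p) (Set.range y) = ⊤ := Nat.find_spec hex
  have hnmin : ∀ (m : ℕ) (y : Fin m → M),
      Submodule.span (IwasawaAlgebra p) (Set.range y) = ⊤ → Nat.find hex ≤ m :=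
    fun m y hy => Nat.find_min' hex ⟨y, hy⟩
  generalize Nat.find hex = g at x hx hnmin
  refine ⟨g, ?_⟩
  -- the presentation `π : Λ^g → X`
  let π : (Fin g → IwasawaAlgebra p) →ₗ[IwasawaAlgebra p] M := Fintype.linearCombination _ x
  have hπ : ∀ c, π c = ∑ i, c i • x i := fun c => Fintype.linearCombination_apply _ _ c
  have hsurj : Function.Surjective π := by
    rw [← LinearMap.range_eq_top, eq_top_iff, ← hx, Submodule.span_le]
    rintro _ ⟨i, rfl⟩
    refine ⟨Pi.single i 1, ?_⟩
    rw [hπ, Finset.sum_eq_single i (fun j _ hj => by rw [Pi.single_eq_of_ne hj, zero_smul])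
      (fun hi => absurd (Finset.mem_univ i) hi), Pi.single_eq_same, one_smul]
  haveI := free_ker π hnf
  let b : Module.Basis (Fin g) (IwasawaAlgebra p) (LinearMap.ker π) :=
    Module.finBasisOfFinrankEq _ _ (finrank_ker_eq π hsurj hM)
  let P : Matrix (Fin g) (Fin g) (IwasawaAlgebra p) :=
    Matrix.of fun t l => ((b t : LinearMap.ker π) : Fin g → IwasawaAlgebra p) l
  have hP : ∀ t, ∑ l, P t l • x l = 0 := fun t => by
    have := (b t).2
    rw [LinearMap.mem_ker, hπ] at this
    simpa [P] using this
  have hK : LinearMap.ker π = Submodule.span (IwasawaAlgebra p) (Set.range P) := by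
    have e : Set.range P = (LinearMap.ker π).subtype '' Set.range b := by
      rw [← Set.range_comp]; rfl
    rw [e, Submodule.span_image, b.span_eq, Submodule.map_subtype_top]
  have hgen : ∀ ρ : Fin g → IwasawaAlgebra p, ∑ l, ρ l • x l = 0 →
      ρ ∈ Submodule.span (IwasawaAlgebra p) (Set.range P) := fun ρ hρ => by
    rw [← hK, LinearMap.mem_ker, hπ]; exact hρ
  refine ⟨P.det, ⟨x, hx⟩, hnmin,
    Module.fittingIdeal_zero_eq_span_det_of_square_presentation x hx P hP hgen, ?_⟩
  exact det_mem_pow_of_forall_mem P fun t l =>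
    relation_mem_maximalIdeal_of_minimal x hx hnmin (P t) (hP t) l

/-- **`char(X) = Fitt₀(X)`, a principal ideal, for `X` f.g. torsion without non-zero finite
submodules** (the tree's `fittingIdeal_zero_le_charIdeal` and
`charIdeal_le_span_singleton_of_fittingIdeal_zero_le` squeeze `char` between `Fitt₀ = (d)` and
`(d)`). [cite: SkinnerUrban2014, §3.1.6 (p. 20)] -/
theorem exists_charIdeal_eq_span_and_fittingIdeal_zero_eq_span [Module.Finite (IwasawaAlgebra p) M]
    (hM : Module.IsTorsion (IwasawaAlgebra p) M)
    (hnf : ∀ N : Submodule (IwasawaAlgebra p) M, Finite N → N = ⊥) :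
    ∃ d : IwasawaAlgebra p, Module.charIdeal (IwasawaAlgebra p) M = Ideal.span {d} ∧
      Module.fittingIdeal (IwasawaAlgebra p) M 0 = Ideal.span {d} := by
  obtain ⟨-, d, -, -, hd, -⟩ := exists_fittingIdeal_zero_eq_span_of_minimal hM hnf
  refine ⟨d, le_antisymm ?_ ?_, hd⟩
  · exact SkinnerUrban2014.charIdeal_le_span_singleton_of_fittingIdeal_zero_le hM hd.le
  · exact hd.ge.trans SkinnerUrban2014.fittingIdeal_zero_le_charIdeal

/-- `char(X) = Fitt₀(X)` for `X` f.g. torsion over `Λ` without non-zero finite submodules.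
[cite: SkinnerUrban2014, §3.1.6 (p. 20)] -/
theorem charIdeal_eq_fittingIdeal_zero [Module.Finite (IwasawaAlgebra p) M]
    (hM : Module.IsTorsion (IwasawaAlgebra p) M)
    (hnf : ∀ N : Submodule (IwasawaAlgebra p) M, Finite N → N = ⊥) :
    Module.charIdeal (IwasawaAlgebra p) M = Module.fittingIdeal (IwasawaAlgebra p) M 0 := by
  obtain ⟨d, hc, hf⟩ := exists_charIdeal_eq_span_and_fittingIdeal_zero_eq_span hM hnf
  rw [hc, hf]

/-- **Square minimal presentation, counted:** with `p^B ≤ #(X/𝔪X)` the generator `d` of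
`Fitt₀(X)` lies in `𝔪^B` (`g ≥ B`). [cite: StacksProject, Tag 07Z6] -/
theorem exists_fittingIdeal_zero_eq_span [Module.Finite (IwasawaAlgebra p) M]
    (hM : Module.IsTorsion (IwasawaAlgebra p) M)
    (hnf : ∀ N : Submodule (IwasawaAlgebra p) M, Finite N → N = ⊥) {B : ℕ}
    (hB : p ^ B ≤ Nat.card (M ⧸ maximalIdeal (IwasawaAlgebra p) •
      (⊤ : Submodule (IwasawaAlgebra p) M))) :
    ∃ d : IwasawaAlgebra p, Module.fittingIdeal (IwasawaAlgebra p) M 0 = Ideal.span {d} ∧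
      d ∈ maximalIdeal (IwasawaAlgebra p) ^ B := by
  obtain ⟨g, d, ⟨x, hx⟩, hmin, hd, hdg⟩ := exists_fittingIdeal_zero_eq_span_of_minimal hM hnf
  exact ⟨d, hd, Ideal.pow_le_pow_right (le_of_pow_le_natCard_quotient hB g x hx) hdg⟩

/-! ## §5. LEMMA M, ord form -/

/-- **LEMMA M (ord form).** For a finitely generated torsion `Λ`-module `X` without non-zero
finite submodules: `p^B ≤ #(X/𝔪X)` ⇒ `char(X) ⊆ 𝔪^B`. (`char ⊆ (det P)` by Skinner–Urban
§3.1.6 in the tree — a principal ideal containing `Fitt₀` contains `char` — and `det P ∈ 𝔪^B`.)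
[cite: SkinnerUrban2014, §3.1.6 (p. 20)] [cite: GreenbergLNM1716, p. 137] -/
theorem charIdeal_le_maximalIdeal_pow [Module.Finite (IwasawaAlgebra p) M]
    (hM : Module.IsTorsion (IwasawaAlgebra p) M)
    (hnf : ∀ N : Submodule (IwasawaAlgebra p) M, Finite N → N = ⊥) {B : ℕ}
    (hB : p ^ B ≤ Nat.card (M ⧸ maximalIdeal (IwasawaAlgebra p) •
      (⊤ : Submodule (IwasawaAlgebra p) M))) :
    Module.charIdeal (IwasawaAlgebra p) M ≤ maximalIdeal (IwasawaAlgebra p) ^ B := by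
  obtain ⟨d, hd, hdB⟩ := exists_fittingIdeal_zero_eq_span hM hnf hB
  exact (SkinnerUrban2014.charIdeal_le_span_singleton_of_fittingIdeal_zero_le hM hd.le).trans
    ((Ideal.span_singleton_le_iff_mem _).2 hdB)

/-- **LEMMA M, coefficient form:** under the same hypotheses, a generator `f` of `char(X)` has
`p^{B−i} ∣ f_i` for every `i` (`ord_𝔪 f = min_i (v_p(f_i) + i) ≥ B`); `i = 0`: `p^B ∣ f(0)`,
LEMMA M₀. [cite: GreenbergLNM1716, p. 137] -/
theorem pow_dvd_coeff_of_charIdeal_eq_span [Module.Finite (IwasawaAlgebra p) M]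
    (hM : Module.IsTorsion (IwasawaAlgebra p) M)
    (hnf : ∀ N : Submodule (IwasawaAlgebra p) M, Finite N → N = ⊥) {B : ℕ}
    (hB : p ^ B ≤ Nat.card (M ⧸ maximalIdeal (IwasawaAlgebra p) •
      (⊤ : Submodule (IwasawaAlgebra p) M)))
    {f : IwasawaAlgebra p} (hchar : Module.charIdeal (IwasawaAlgebra p) M = Ideal.span {f})
    (i : ℕ) : (p : ℤ_[p]) ^ (B - i) ∣ coeff i f :=
  pow_dvd_coeff_of_mem_maximalIdeal_pow
    (charIdeal_le_maximalIdeal_pow hM hnf hB (hchar ▸ Ideal.mem_span_singleton_self f)) i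

/-! ## §6. Route M's reading: `GeneratorCountGE` + `NoFiniteSubmoduleAt` ⇒ `char X(E/ℚ_∞) ⊆ 𝔪^B` -/

section Selmer

open WeierstrassCurve

/-- **Route M, LEMMA M in the kernel:** under the typed count `GeneratorCountGE W p B` and
`NoFiniteSubmoduleAt p W` (Greenberg Prop. 4.14/4.15), every torsion Pontryagin-dual Selmer
datum `D` over the cyclotomic tower has `char(D.X) ⊆ 𝔪^B`; so a characteristic power series
`f_E` satisfies `p^{B−i} ∣ (f_E)_i` for all `i`. [cite: GreenbergLNM1716, p. 137 (the count; shape only)] -/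
theorem charIdeal_le_of_generatorCountGE {W : WeierstrassCurve ℚ} [W.IsElliptic]
    [W.IsGloballyMinimal] {B : ℕ}
    (hcount : GeneratorCountSqueeze.GeneratorCountGE W p B)
    (hnf : Additive.NoFiniteSubmoduleAt p W)
    (κ : ZpExtension ℚ p) (γ : Field.absoluteGaloisGroup ℚ) (hκ : κ.IsCyclotomic)
    (hγ : κ.IsTopGenerator γ) (hγv : IsCyclotomicVariable p γ) (D : W.SelmerDualData κ γ)
    [Module.Finite (IwasawaAlgebra p) D.X] (hD : D.IsTorsion) :
    Module.charIdeal (IwasawaAlgebra p) D.X ≤ maximalIdeal (IwasawaAlgebra p) ^ B :=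
  charIdeal_le_maximalIdeal_pow hD (hnf hκ hγ hγv D hD) (hcount κ γ hκ hγ hγv D hD)

/-- Coefficient form of the previous theorem. [cite: GreenbergLNM1716, p. 137 (the count; shape only)] -/
theorem pow_dvd_coeff_of_generatorCountGE {W : WeierstrassCurve ℚ} [W.IsElliptic]
    [W.IsGloballyMinimal] {B : ℕ}
    (hcount : GeneratorCountSqueeze.GeneratorCountGE W p B)
    (hnf : Additive.NoFiniteSubmoduleAt p W)
    (κ : ZpExtension ℚ p) (γ : Field.absoluteGaloisGroup ℚ) (hκ : κ.IsCyclotomic)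
    (hγ : κ.IsTopGenerator γ) (hγv : IsCyclotomicVariable p γ) (D : W.SelmerDualData κ γ)
    [Module.Finite (IwasawaAlgebra p) D.X] (hD : D.IsTorsion) {f : IwasawaAlgebra p}
    (hchar : Module.charIdeal (IwasawaAlgebra p) D.X = Ideal.span {f}) (i : ℕ) :
    (p : ℤ_[p]) ^ (B - i) ∣ coeff i f :=
  pow_dvd_coeff_of_charIdeal_eq_span hD (hnf hκ hγ hγv D hD) (hcount κ γ hκ hγ hγv D hD) hchar i

end Selmer

end Summit.BirchSwinnertonDyer.Rank1Residual.X1.GeneratorBoundOrd
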